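/-
Copyright (c) 2026. All rights reserved.
Released under Apache 2.0 license as described in the file LICENSE.
-/
import Literature.NumberTheory.Automorphic.DefiniteMaximalOrdersTypeFibres
import Literature.NumberTheory.Automorphic.BrandtMultiplicativityHolds
import Literature.NumberTheory.Automorphic.BrandtMatrixOne
import Mathlib.GroupTheory.NoncommPiCoprod
import Mathlib.GroupTheory.GroupAction.Quotient
import HarnessLib

/-!
# The type number of the maximal orders of a definite quaternion algebra of squarefree discriminant `N⁻` from the traces of
# the Brandt matrices: `∑_{d ∣ N⁻} tr T(d) = 2^r · #Typ O`, `r = ω(N⁻)` (Vignéras V §2; Deuring, Eichler, Pizer)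

[tag: quaternion_algebra] [tag: class_number] [tag: maximal_order] [tag: hecke_operator]

Topic `NumberTheory/Automorphic`; THEOREMS ONLY (no definition, no named fact, no instance; net Literature debt `0`).
Lane `lit-hodgefound`, seat p12, gen 51 — the count announced in the Scope of `DefiniteMaximalOrdersTypeFibres.lean`: for a
Brandt setup `S : XiSetup 1 N⁻` (maximal orders `O` of the definite quaternion algebra of squarefree discriminant `N⁻ = q₁ ⋯ q_r`)
the pairwise commuting Atkin–Lehner involutions `W_{q⁻} : [I] ↦ [I 𝔓_q]` (`BrandtSetupAtkinLehnerInvolutions.lean`) define an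
action of the elementary abelian group `(ℤ/2ℤ)^r` on `Cls O` whose orbits are the fibres of the type map `Cls O → Typ O`
(`DefiniteMaximalOrdersTypeFibres.lean`); for a squarefree `d = ∏_{q ∈ s} q ∣ N⁻` the Brandt matrix `T(d) = ∏_{q ∈ s} T(q)` is the
permutation matrix of `W_s = ∏_{q ∈ s} W_{q⁻}`, so `tr T(d)` is the number of classes fixed by `W_s`, and Burnside's lemma gives

  **`∑_{d ∣ N⁻} tr T(d) = 2^r · #Typ O`** (`XiSetup.sum_divisors_trace_matrix_eq`),

the identity by which Vignéras (Ch. V §2, the paragraph after Cor. 2.5: with `2^r = [N(O_A) : O_A^× K_A^×]` and `(A)` a system of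
reduced norms of two-sided ideals modulo squares, the sum `∑_A trace P(A)` of the traces of the Eichler–Brandt matrices is computed
fibre by fibre, «d'où une expression pour `t`»), and before her Deuring (`N⁻ = p`: `2t = h + tr T(p)`, the tree's
`DeuringTypeNumberFormula.lean`), Eichler and Pizer compute type numbers from traces of Brandt matrices; here `r = ω(N⁻)`.

* §1 (private, group theory) commuting involutions `W_i` (`i ∈ ι` finite) of a set `X` extend to a homomorphism
  `Φ : (ι → ℤ/2ℤ) → Sym X` (`MonoidHom.noncommPiCoprod`), and the `Φ`-orbit of `x` is the set of classes reachable from `x` by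
  the `W_i`;
* §2 **`XiSetup.matrix_prod_primeFactors_apply`** (private form with `Φ`) and **`XiSetup.sum_trace_matrix_prod_primeFactors_eq`**:
  `∑_{s ⊆ {q ∣ N⁻}} tr T(∏_{q∈s} q) = 2^r · #Typ O` (Burnside for the `(ℤ/2ℤ)^r`-action, orbits = fibres of `typeOf` by
  `XiSetup.typeOf_eq_typeOf_iff_reflTransGen_wMinus`);
* §3 **`XiSetup.sum_divisors_trace_matrix_eq`**: `∑_{d ∣ N⁻} tr T(d) = 2^r · #Typ O` (reindexing by `s ↦ ∏ s`, `N⁻` squarefree),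
  and the bound **`XiSetup.natCard_classSet_le_two_pow_mul_natCard_typeSet`**: `#Cls O ≤ 2^r · #Typ O` (the term `d = 1` is
  `tr T(1) = #Cls O`; Voight Cor. 18.5.12: `#Cls O = ∑_{[O']} [Idl(O') : PIdl(O')] ≤ #Pic(O) · #Typ O`).

## References

* [VignerasLNM800] M.-F. Vignéras, *Arithmétique des algèbres de quaternions*, LNM 800 (1980), Ch. V §2, Prop. 2.4 (trace des
  matrices d'Eichler–Brandt), Cor. 2.5 and the paragraph following it (`h'_i`, `2^r`, «`∑_A trace P(A)` … d'où une expression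
  pour `t`»), Cor. 2.6 (nombre de types); Ch. III §5 exercice 5.8 (the matrices `P(A)`). (Pages 117–118 of the held copy.)
* [Voight2021] J. Voight, *Quaternion Algebras*, GTM 288 (2021): Thm. 18.1.3, Prop. 18.5.10, Cor. 18.5.12, (30.9.3)–(30.9.4),
  41.3.4–(41.3.5).

## Scope (honest)

Theorems only, maximal orders (`N⁺ = 1`), statements over `ℤ` (traces of the integral Brandt matrices `Brandt.matrix`). Not here:
the evaluation of the individual traces `tr T(d)` by embedding numbers (Vignéras V Prop. 2.4 / Eichler's trace formula), hence no
closed formula for `t`; Eichler orders of level `N⁺ > 1`.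
-/

noncomputable section

open scoped Pointwise

universe u

namespace Literature.NumberTheory.Automorphic

namespace Brandt

/-! ## §1 Commuting involutions: the action of `(ℤ/2ℤ)^ι` -/

/-- Pairwise commuting involutions `W_i` of `X` (`i ∈ ι`, finite) extend to a homomorphism `(ι → ℤ/2ℤ) → Sym X` sending the
`i`-th basis vector to `W_i`. [folklore] -/
private theorem exists_monoidHom_of_commuting_involutions {X ι : Type*} [Fintype ι] [DecidableEq ι]
    (W : ι → Equiv.Perm X) (hW2 : ∀ i, W i ^ 2 = 1) (hc : ∀ i j, Commute (W i) (W j)) :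
    ∃ Φ : (ι → Multiplicative (ZMod 2)) →* Equiv.Perm X,
      ∀ i, Φ (Pi.mulSingle i (Multiplicative.ofAdd 1)) = W i := by
  have hpow : ∀ i (k : ℕ), W i ^ (k % 2) = W i ^ k := fun i k => by
    conv_rhs => rw [← Nat.mod_add_div k 2, pow_add, pow_mul, hW2 i, one_pow, mul_one]
  let ϕ : ∀ _ : ι, Multiplicative (ZMod 2) →* Equiv.Perm X := fun i =>
    { toFun := fun z => W i ^ (Multiplicative.toAdd z).val
      map_one' := by simp
      map_mul' := fun a b => by simp only [toAdd_mul, ZMod.val_add, hpow, pow_add] }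
  have hϕ : ∀ i z, ϕ i z = W i ^ (Multiplicative.toAdd z).val := fun _ _ => rfl
  have hcomm : Pairwise fun i j => ∀ a b, Commute (ϕ i a) (ϕ j b) := fun i j _ a b => by
    rw [hϕ, hϕ]; exact (hc i j).pow_pow _ _
  refine ⟨MonoidHom.noncommPiCoprod ϕ hcomm, fun i => ?_⟩
  rw [MonoidHom.noncommPiCoprod_mulSingle, hϕ, toAdd_ofAdd, ZMod.val_one, pow_one]

/-- The two elements of `ℤ/2ℤ` (multiplicative notation). [folklore] -/
private theorem eq_one_or_eq_ofAdd_one (z : Multiplicative (ZMod 2)) : z = 1 ∨ z = Multiplicative.ofAdd 1 := by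
  revert z; decide

/-- Every `Φ(g) x` is reachable from `x` by the involutions `W_i`. [folklore] -/
private theorem reflTransGen_hom_apply {X ι : Type*} [Fintype ι] [DecidableEq ι] (W : ι → Equiv.Perm X)
    (Φ : (ι → Multiplicative (ZMod 2)) →* Equiv.Perm X) (hΦ : ∀ i, Φ (Pi.mulSingle i (Multiplicative.ofAdd 1)) = W i)
    (g : ι → Multiplicative (ZMod 2)) (x : X) :
    Relation.ReflTransGen (fun a b => ∃ i, W i a = b) x (Φ g x) := by
  suffices key : ∀ s : Finset ι,
      Relation.ReflTransGen (fun a b => ∃ i, W i a = b) x (Φ (∏ i ∈ s, Pi.mulSingle i (g i)) x) by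
    have := key Finset.univ
    rwa [Finset.univ_prod_mulSingle] at this
  intro s
  induction s using Finset.induction_on with
  | empty =>
    rw [show Φ (∏ i ∈ (∅ : Finset ι), Pi.mulSingle i (g i)) x = x by
      rw [Finset.prod_empty, map_one, Equiv.Perm.coe_one, id_eq]]
  | @insert j s hj ih =>
    rw [Finset.prod_insert hj, map_mul, Equiv.Perm.coe_mul, Function.comp_apply]
    rcases eq_one_or_eq_ofAdd_one (g j) with h | h
    · rw [h, Pi.mulSingle_one, map_one, Equiv.Perm.coe_one, id_eq]; exact ih
    · rw [h, hΦ]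
      exact ih.tail ⟨j, rfl⟩

/-- Conversely, a class reachable from `x` by the `W_i` is some `Φ(g) x`. [folklore] -/
private theorem exists_hom_apply_eq_of_reflTransGen {X ι : Type*} [Fintype ι] [DecidableEq ι] (W : ι → Equiv.Perm X)
    (Φ : (ι → Multiplicative (ZMod 2)) →* Equiv.Perm X) (hΦ : ∀ i, Φ (Pi.mulSingle i (Multiplicative.ofAdd 1)) = W i)
    {x y : X} (h : Relation.ReflTransGen (fun a b => ∃ i, W i a = b) x y) :
    ∃ g : ι → Multiplicative (ZMod 2), Φ g x = y := by
  induction h with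
  | refl => exact ⟨1, by rw [map_one, Equiv.Perm.coe_one, id_eq]⟩
  | tail _ hbc ih =>
    obtain ⟨g, rfl⟩ := ih
    obtain ⟨i, rfl⟩ := hbc
    exact ⟨Pi.mulSingle i (Multiplicative.ofAdd 1) * g, by rw [map_mul, Equiv.Perm.coe_mul, Function.comp_apply, hΦ]⟩

/-- Subsets of `ι` as elements of `(ℤ/2ℤ)^ι` (indicator vectors). [folklore] -/
private theorem exists_equiv_finset_fun (ι : Type*) [Fintype ι] [DecidableEq ι] :
    ∃ e : Finset ι ≃ (ι → Multiplicative (ZMod 2)), ∀ s, e s = fun i => if i ∈ s then Multiplicative.ofAdd 1 else 1 := by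
  have h10 : (Multiplicative.ofAdd (1 : ZMod 2)) ≠ 1 := by decide
  refine ⟨⟨fun s i => if i ∈ s then Multiplicative.ofAdd 1 else 1, fun g => Finset.univ.filter fun i => g i ≠ 1,
    fun s => ?_, fun g => ?_⟩, fun s => rfl⟩
  · ext i
    simp only [Finset.mem_filter, Finset.mem_univ, true_and]
    by_cases hi : i ∈ s
    · simp [hi, h10]
    · simp [hi]
  · funext i
    simp only [Finset.mem_filter, Finset.mem_univ, true_and]
    rcases eq_one_or_eq_ofAdd_one (g i) with h | h
    · simp [h]
    · simp [h, h10]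

/-! ## §2 Brandt setups: `T(∏_{q∈s} q)` is the permutation matrix of `∏_{q∈s} W_{q⁻}` and Burnside's count -/

variable {Nminus : ℕ} (S : XiSetup 1 Nminus)

/-- The primes of `N⁻` are pairwise coprime: `q ∤ ∏_{q' ∈ s} q'` for `q ∉ s`. [folklore] -/
private theorem coprime_prod_of_notMem {s : Finset ↥Nminus.primeFactors} {j : ↥Nminus.primeFactors} (hj : j ∉ s) :
    Nat.Coprime (j : ℕ) (∏ q ∈ s, (q : ℕ)) := by
  refine Nat.Coprime.prod_right fun q hq => (Nat.coprime_primes (Nat.prime_of_mem_primeFactors j.2)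
    (Nat.prime_of_mem_primeFactors q.2)).mpr fun e => hj ?_
  have : j = q := Subtype.ext e
  rw [this]; exact hq

open Classical in
/-- **`T(∏_{q ∈ s} q)` is the permutation matrix of `W_s = ∏_{q ∈ s} W_{q⁻}`** for every set `s` of primes of `N⁻`: with `Φ` the
action of `(ℤ/2ℤ)^r` generated by the `W_{q⁻}`, `T(∏ s)_{c c'} = [c = Φ(1_s) c']` — by `T(q) = ` permutation matrix of `W_{q⁻}`
(`XiSetup.matrix_ramified_apply_of_dvd`) and `T(mn) = T(m) T(n)` for coprime `m, n`. [cite: VignerasLNM800, Ch. III §5 exercice 5.8 (b)–(c)] -/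
private theorem XiSetup.matrix_prod_primeFactors_apply [Fintype (ClassSet S.O)]
    (Φ : (↥Nminus.primeFactors → Multiplicative (ZMod 2)) →* Equiv.Perm (ClassSet S.O))
    (hΦ : ∀ (q : ℕ) (_ : Fact q.Prime) (hq : q ∈ Nminus.primeFactors) (c : ClassSet S.O),
      Φ (Pi.mulSingle ⟨q, hq⟩ (Multiplicative.ofAdd 1)) c = S.wMinus q (Nat.dvd_of_mem_primeFactors hq) c)
    (s : Finset ↥Nminus.primeFactors) (c c' : ClassSet S.O) :
    matrix S.O (∏ q ∈ s, (q : ℕ)) c c' =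
      if c = Φ (fun q => if q ∈ s then Multiplicative.ofAdd 1 else 1) c' then 1 else 0 := by
  induction s using Finset.induction_on generalizing c c' with
  | empty =>
    have h1 : (fun q : ↥Nminus.primeFactors => if q ∈ (∅ : Finset ↥Nminus.primeFactors) then
        Multiplicative.ofAdd (1 : ZMod 2) else 1) = 1 := by
      funext q; simp
    rw [h1, map_one, Finset.prod_empty, Brandt.matrix_one S.O, Matrix.one_apply, Equiv.Perm.coe_one, id_eq]
  | @insert j s hj ih =>
    haveI : Fact (j : ℕ).Prime := ⟨Nat.prime_of_mem_primeFactors j.2⟩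
    have hins : (fun q : ↥Nminus.primeFactors => if q ∈ insert j s then Multiplicative.ofAdd (1 : ZMod 2) else 1) =
        Pi.mulSingle j (Multiplicative.ofAdd 1) * fun q => if q ∈ s then Multiplicative.ofAdd 1 else 1 := by
      funext q
      rw [Pi.mul_apply]
      by_cases hqj : q = j
      · subst hqj
        rw [Pi.mulSingle_eq_same, if_pos (Finset.mem_insert_self q s), if_neg hj, mul_one]
      · rw [Pi.mulSingle_eq_of_ne hqj, one_mul]
        simp [Finset.mem_insert, hqj]
    rw [hins, map_mul, Equiv.Perm.coe_mul, Function.comp_apply, Finset.prod_insert hj,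
      S.matrix_mul_of_coprime (coprime_prod_of_notMem hj), Matrix.mul_apply]
    have hj' : Φ (Pi.mulSingle j (Multiplicative.ofAdd 1)) = fun d => S.wMinus j (Nat.dvd_of_mem_primeFactors j.2) d := by
      funext d
      have := hΦ j inferInstance j.2 d
      exact this
    simp_rw [ih, S.matrix_ramified_apply_of_dvd (Nat.dvd_of_mem_primeFactors j.2)]
    simp only [mul_ite, mul_one, mul_zero, Finset.sum_ite_eq', Finset.mem_univ, if_true]
    rw [hj']

open Classical in
/-- **`tr T(∏_{q∈s} q)` is the number of classes fixed by `W_s`.** [cite: VignerasLNM800, Ch. V §2 (the diagonal of `P(A)`)] -/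
private theorem XiSetup.trace_matrix_prod_primeFactors [Fintype (ClassSet S.O)]
    (Φ : (↥Nminus.primeFactors → Multiplicative (ZMod 2)) →* Equiv.Perm (ClassSet S.O))
    (hΦ : ∀ (q : ℕ) (_ : Fact q.Prime) (hq : q ∈ Nminus.primeFactors) (c : ClassSet S.O),
      Φ (Pi.mulSingle ⟨q, hq⟩ (Multiplicative.ofAdd 1)) c = S.wMinus q (Nat.dvd_of_mem_primeFactors hq) c)
    (s : Finset ↥Nminus.primeFactors) :
    (matrix S.O (∏ q ∈ s, (q : ℕ))).trace =
      ((Finset.univ.filter fun c : ClassSet S.O =>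
        Φ (fun q => if q ∈ s then Multiplicative.ofAdd 1 else 1) c = c).card : ℤ) := by
  simp only [Matrix.trace, Matrix.diag_apply, S.matrix_prod_primeFactors_apply Φ hΦ s]
  rw [Finset.natCast_card_filter]
  refine Finset.sum_congr rfl fun c _ => ?_
  simp only [eq_comm]

/-- **`∑_{s ⊆ {q ∣ N⁻}} tr T(∏_{q∈s} q) = 2^r · #Typ O`** (`r = ω(N⁻)`): Burnside's lemma for the action of `(ℤ/2ℤ)^r` on `Cls O`
by the Atkin–Lehner involutions `W_{q⁻}`, whose orbits are the fibres of the type map (`XiSetup.typeOf_eq_typeOf_iff_reflTransGen_wMinus`)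
and whose elements `1_s` have `tr T(∏ s)` fixed points (Vignéras V §2: the type number from the traces of the `P(A)`).
[cite: VignerasLNM800, Ch. V §2 (after Cor. 2.5)] [cite: Voight2021, Thm. 18.1.3 and Cor. 18.5.12] -/
theorem XiSetup.sum_trace_matrix_prod_primeFactors_eq [Fintype (ClassSet S.O)] :
    ∑ s : Finset ↥Nminus.primeFactors, (matrix S.O (∏ q ∈ s, (q : ℕ))).trace =
      ((2 ^ Nminus.primeFactors.card * Nat.card (TypeSet S.O) : ℕ) : ℤ) := by
  classical
  have hN0 : Nminus ≠ 0 := S.squarefree.ne_zero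
  -- the involutions `W_{q⁻}` as permutations of `Cls O`
  set W : ↥Nminus.primeFactors → Equiv.Perm (ClassSet S.O) := fun q =>
    haveI : Fact (q : ℕ).Prime := ⟨Nat.prime_of_mem_primeFactors q.2⟩
    (S.involutive_wMinus (Nat.dvd_of_mem_primeFactors q.2)).toPerm _ with hWdef
  have hWapp : ∀ (q : ↥Nminus.primeFactors) (c : ClassSet S.O),
      W q c = @XiSetup.wMinus 1 Nminus S q ⟨Nat.prime_of_mem_primeFactors q.2⟩ (Nat.dvd_of_mem_primeFactors q.2) c :=
    fun q c => rfl
  have hW2 : ∀ q, W q ^ 2 = 1 := fun q => by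
    ext c
    rw [sq, Equiv.Perm.coe_mul, Function.comp_apply, hWapp, hWapp, Equiv.Perm.coe_one, id_eq]
    exact @XiSetup.wMinus_wMinus 1 Nminus S q ⟨Nat.prime_of_mem_primeFactors q.2⟩ (Nat.dvd_of_mem_primeFactors q.2) c
  have hc : ∀ q q', Commute (W q) (W q') := fun q q' => by
    ext c
    rw [Equiv.Perm.coe_mul, Function.comp_apply, Equiv.Perm.coe_mul, Function.comp_apply, hWapp, hWapp, hWapp, hWapp]
    exact @XiSetup.wMinus_comm 1 Nminus S q q' ⟨Nat.prime_of_mem_primeFactors q.2⟩ ⟨Nat.prime_of_mem_primeFactors q'.2⟩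
      (Nat.dvd_of_mem_primeFactors q.2) (Nat.dvd_of_mem_primeFactors q'.2) c
  obtain ⟨Φ, hΦ⟩ := exists_monoidHom_of_commuting_involutions W hW2 hc
  have hΦ' : ∀ (q : ℕ) (_ : Fact q.Prime) (hq : q ∈ Nminus.primeFactors) (c : ClassSet S.O),
      Φ (Pi.mulSingle ⟨q, hq⟩ (Multiplicative.ofAdd 1)) c = S.wMinus q (Nat.dvd_of_mem_primeFactors hq) c := by
    intro q _ hq c
    rw [hΦ ⟨q, hq⟩, hWapp]
  -- the action of `G = (ℤ/2ℤ)^r` on `Cls O` through `Φ`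
  letI : MulAction (↥Nminus.primeFactors → Multiplicative (ZMod 2)) (ClassSet S.O) := MulAction.compHom _ Φ
  have hsmul : ∀ (g : ↥Nminus.primeFactors → Multiplicative (ZMod 2)) (c : ClassSet S.O), g • c = Φ g c := fun _ _ => rfl
  have burnside := MulAction.sum_card_fixedBy_eq_card_orbits_mul_card_group
    (↥Nminus.primeFactors → Multiplicative (ZMod 2)) (ClassSet S.O)
  -- `#G = 2^r`
  have hG : Fintype.card (↥Nminus.primeFactors → Multiplicative (ZMod 2)) = 2 ^ Nminus.primeFactors.card := by
    rw [Fintype.card_fun, Fintype.card_multiplicative, ZMod.card, Fintype.card_coe]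
  -- the orbits are the fibres of the type map
  have horb : ∀ a b : ClassSet S.O,
      (MulAction.orbitRel (↥Nminus.primeFactors → Multiplicative (ZMod 2)) (ClassSet S.O)) a b ↔ typeOf S.O a = typeOf S.O b := by
    intro a b
    rw [MulAction.orbitRel_apply, MulAction.mem_orbit_iff, S.typeOf_eq_typeOf_iff_reflTransGen_wMinus]
    constructor
    · rintro ⟨g, rfl⟩
      rw [hsmul]
      refine Relation.ReflTransGen.mono (fun x y => ?_) _ _ (reflTransGen_hom_apply W Φ hΦ g b)
      rintro ⟨q, rfl⟩
      exact ⟨q, ⟨Nat.prime_of_mem_primeFactors q.2⟩, Nat.dvd_of_mem_primeFactors q.2, (hWapp q x).symm⟩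
    · intro h
      have h' : Relation.ReflTransGen (fun x y => ∃ i, W i x = y) b a := by
        refine Relation.ReflTransGen.mono (fun x y => ?_) _ _ h
        rintro ⟨q, hf, hq, rfl⟩
        exact ⟨⟨q, Nat.mem_primeFactors.mpr ⟨hf.out, hq, hN0⟩⟩, by rw [hWapp]⟩
      obtain ⟨g, hg⟩ := exists_hom_apply_eq_of_reflTransGen W Φ hΦ h'
      exact ⟨g, by rw [hsmul, hg]⟩
  have hΩ : Fintype.card (Quotient (MulAction.orbitRel (↥Nminus.primeFactors → Multiplicative (ZMod 2)) (ClassSet S.O))) =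
      Nat.card (TypeSet S.O) := by
    haveI : Finite (TypeSet S.O) := S.finite_typeSet
    haveI : Fintype (TypeSet S.O) := Fintype.ofFinite _
    rw [Nat.card_eq_fintype_card]
    exact Fintype.card_congr (Quotient.congrRight fun a b => (horb a b).trans typeOf_eq_typeOf_iff)
  -- the fixed points of `1_s` are counted by `tr T(∏ s)`
  obtain ⟨e, he⟩ := exists_equiv_finset_fun ↥Nminus.primeFactors
  have hfix : ∀ s : Finset ↥Nminus.primeFactors, (matrix S.O (∏ q ∈ s, (q : ℕ))).trace =
      (Fintype.card (MulAction.fixedBy (ClassSet S.O) (e s)) : ℤ) := by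
    intro s
    rw [S.trace_matrix_prod_primeFactors Φ hΦ' s, ← he s]
    congr 1
    refine (Fintype.card_of_subtype _ fun c => ?_).symm
    rw [Finset.mem_filter, MulAction.mem_fixedBy, hsmul]
    simp
  calc ∑ s : Finset ↥Nminus.primeFactors, (matrix S.O (∏ q ∈ s, (q : ℕ))).trace
      = ∑ s : Finset ↥Nminus.primeFactors, (Fintype.card (MulAction.fixedBy (ClassSet S.O) (e s)) : ℤ) :=
        Finset.sum_congr rfl fun s _ => hfix s
    _ = ∑ g : ↥Nminus.primeFactors → Multiplicative (ZMod 2), (Fintype.card (MulAction.fixedBy (ClassSet S.O) g) : ℤ) :=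
        Fintype.sum_equiv e _ _ fun s => rfl
    _ = ((2 ^ Nminus.primeFactors.card * Nat.card (TypeSet S.O) : ℕ) : ℤ) := by
        rw [← Nat.cast_sum, burnside, hΩ, hG, mul_comm]

/-! ## §3 `∑_{d ∣ N⁻} tr T(d) = 2^r · #Typ O` -/

/-- **THE TYPE NUMBER FROM THE TRACES OF THE BRANDT MATRICES** (maximal orders of the definite quaternion algebra of squarefree
discriminant `N⁻`, `r = ω(N⁻)` prime factors): **`∑_{d ∣ N⁻} tr T(d) = 2^r · #Typ O`** — the sum of the traces of the
Eichler–Brandt matrices `P(A)`, `A` over the reduced norms of two-sided ideals modulo squares (here: the divisors of `N⁻`), counts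
every type `2^r` times (Vignéras V §2 after Cor. 2.5, «d'où une expression pour `t`»; the traces themselves are given by her
Prop. 2.4). For `N⁻ = p` this is Deuring's `2t = h + tr T(p)`. [cite: VignerasLNM800, Ch. V §2 (after Cor. 2.5)] [cite: Voight2021, Thm. 18.1.3 and Cor. 18.5.12] -/
theorem XiSetup.sum_divisors_trace_matrix_eq [Fintype (ClassSet S.O)] :
    ∑ d ∈ Nminus.divisors, (matrix S.O d).trace = ((2 ^ Nminus.primeFactors.card * Nat.card (TypeSet S.O) : ℕ) : ℤ) := by
  classical
  have hN0 : Nminus ≠ 0 := S.squarefree.ne_zero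
  have hmap : ∀ s : Finset ↥Nminus.primeFactors,
      ∏ q ∈ s, (q : ℕ) = ∏ p ∈ s.map (Function.Embedding.subtype _), p := fun s => by
    simp only [Finset.prod_map, Function.Embedding.coe_subtype]
  rw [← S.sum_trace_matrix_prod_primeFactors_eq]
  symm
  refine Finset.sum_bij (fun s _ => ∏ q ∈ s, (q : ℕ)) (fun s _ => ?_) (fun s₁ _ s₂ _ h => ?_) (fun d hd => ?_) (fun _ _ => rfl)
  · -- `∏ s ∣ N⁻`
    rw [Nat.mem_divisors]
    refine ⟨?_, hN0⟩
    rw [hmap]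
    exact Finset.prod_primes_dvd Nminus (fun p hp => by
        obtain ⟨q, -, rfl⟩ := Finset.mem_map.mp hp
        exact Nat.prime_iff.mp (Nat.prime_of_mem_primeFactors q.2))
      (fun p hp => by
        obtain ⟨q, -, rfl⟩ := Finset.mem_map.mp hp
        exact Nat.dvd_of_mem_primeFactors q.2)
  · -- injective: the set of primes of a squarefree product
    have key : ∀ s : Finset ↥Nminus.primeFactors, (∏ q ∈ s, (q : ℕ)).primeFactors =
        s.map (Function.Embedding.subtype _) := fun s => by
      rw [hmap]
      exact Nat.primeFactors_prod fun p hp => by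
        obtain ⟨q, -, rfl⟩ := Finset.mem_map.mp hp
        exact Nat.prime_of_mem_primeFactors q.2
    have h' := key s₁
    rw [h, key s₂] at h'
    exact Finset.map_injective _ h'.symm
  · -- surjective: `d = ∏_{p ∣ d} p` for `d ∣ N⁻` (squarefree)
    obtain ⟨hdvd, -⟩ := Nat.mem_divisors.mp hd
    refine ⟨(d.primeFactors).subtype (· ∈ Nminus.primeFactors), Finset.mem_univ _, ?_⟩
    rw [hmap, Finset.subtype_map,
      Finset.filter_true_of_mem fun p hp => Nat.primeFactors_mono hdvd hN0 hp]
    exact Nat.prod_primeFactors_of_squarefree (S.squarefree.squarefree_of_dvd hdvd)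

/-- The traces of the Brandt matrices are non-negative (their entries count ideals). [cite: Voight2021, 41.1.3] -/
theorem XiSetup.trace_matrix_nonneg [Fintype (ClassSet S.O)] (n : ℕ) : 0 ≤ (matrix S.O n).trace :=
  Finset.sum_nonneg fun c _ => by
    simp only [Matrix.diag_apply, matrix, Matrix.of_apply]
    exact Nat.cast_nonneg _

/-- **`#Cls O ≤ 2^r · #Typ O`** (`r = ω(N⁻)`): the term `d = 1` of `∑_{d ∣ N⁻} tr T(d) = 2^r t` is `tr T(1) = #Cls O` and the
others are `≥ 0` — each fibre of the type map has at most `#(Idl(O')/ℚ^×) = 2^r` elements (Voight Cor. 18.5.12 with Thm. 18.1.3).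
[cite: Voight2021, Thm. 18.1.3 and Cor. 18.5.12] -/
theorem XiSetup.natCard_classSet_le_two_pow_mul_natCard_typeSet :
    Nat.card (ClassSet S.O) ≤ 2 ^ Nminus.primeFactors.card * Nat.card (TypeSet S.O) := by
  classical
  haveI : Fintype (ClassSet S.O) := Fintype.ofFinite _
  have hN0 : Nminus ≠ 0 := S.squarefree.ne_zero
  have h := S.sum_divisors_trace_matrix_eq
  have h1 : (matrix S.O 1).trace = Nat.card (ClassSet S.O) := by
    rw [Brandt.matrix_one S.O, Matrix.trace_one, Nat.card_eq_fintype_card]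
  have hle : (matrix S.O 1).trace ≤ ∑ d ∈ Nminus.divisors, (matrix S.O d).trace :=
    Finset.single_le_sum (fun d _ => S.trace_matrix_nonneg d) (Nat.one_mem_divisors.mpr hN0)
  rw [h, h1] at hle
  exact_mod_cast hle

end Brandt

end Literature.NumberTheory.Automorphic
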